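import Summits.KontsevichZagierPeriods.KontsevichZagierPeriods.Theses.SymplecticScissors
import Literature.NumberTheory.Transcendental.AyoubPeriodSeries
import Literature.NumberTheory.Transcendental.AyoubPeriodSeriesKernel
import Literature.NumberTheory.Transcendental.AyoubPeriodSeriesPiAlgebraic
import Summits.KontsevichZagierPeriods.KontsevichZagierPeriods.Theorems.UnfoldedStokesStokesGenerationStubSpanToRepsAuxCoeff
import Mathlib.RingTheory.MvPowerSeries.Rename
import Mathlib.RingTheory.MvPowerSeries.Substitution
import Summits.KontsevichZagierPeriods.KontsevichZagierPeriods.Theorems.SymplecticScissorsTypeAGenerationStubSubstRoomAux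

/-!
# `TypeAGeneration` (stmt-KontsevichZagierPeriods-18392), line `Sketch`: stub `stub_substRoom` (S3)

Crux `Summit.KontsevichZagierPeriods.KontsevichZagierPeriods.Theses.SymplecticScissors.TypeAGeneration`
(Ayoub 2015 Conj. 1.1 = Fresán 2024 Conj. 3.5), line `Sketch` (radius amplification inside Ayoub's
algebra `𝒪_{k-alg}(𝔻̄^∞) = AyoubRel.Oan σ`). **Stub S3**: for `F ∈ 𝒪_{k-alg}(𝔻̄^∞)` free of `z_j`
(`i ≠ j`), with anisotropic weights `ρ > 1` (`Σ_a ‖F_a‖ ρ^a < ∞`) and a rational `0 < μ < ρᵢ − 1`,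
the substituted series `T = F(zᵢ(1 − μ z_j), w)` (`MvPowerSeries.subst` of the family
`a = (zᵢ − μ zᵢ z_j; z_l for l ≠ i)`) lies in `𝒪_{k-alg}(𝔻̄^∞)`, carries the weights
`ρ[i ↦ θᵢ][j ↦ θ_j]` whenever `θᵢ, θ_j ≥ 0` and `θᵢ (1 + μ θ_j) ≤ ρᵢ`, and involves only `z_j` and
the variables of `F`.

Proof (all `[folklore]`; no definition is introduced), on top of the auxiliary file
`SymplecticScissorsTypeAGenerationStubSubstRoomAux.lean` (coefficient formula
`T_{d + m e_j} = F_d C(dᵢ, m) (−μ)^m` for `d_j = 0`, variables of `T`, algebraicity by transport):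

* `s3_summable_weights`: fibrewise over `e = d + m e_j` the weighted family is
  `‖F_d‖ ρ^{d − dᵢ eᵢ} θᵢ^{dᵢ} C(dᵢ, m) (μ θ_j)^m`, with fibre sums
  `‖F_d‖ ρ^{d − dᵢ eᵢ} (θᵢ (1 + μ θ_j))^{dᵢ} ≤ ‖F_d‖ ρ^d` (binomial theorem); a non-negative family
  on a product is summable when its fibres and fibre sums are (`summable_prod_of_nonneg`), and the
  result is transported along the injection `e ↦ (e − e_j e_j, e_j)`;
* `s3_hasPolyradiusGtOne`: with `t > 1`, `t (1 + μ t) ≤ ρᵢ` (room: `1 + μ < ρᵢ`) and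
  `θᵢ = θ_j = t`, the weights are `≥ r₁ > 1` on the finitely many variables of `T`, so
  `Σ ‖T_e‖ r₁^{|e|} < ∞`;
* `stub_substRoom`: assembly (`DependsOnlyOnLT` from the variables statement).
-/

noncomputable section

-- `Summit.KontsevichZagierPeriods.KontsevichZagierPeriods.…` is the tree's mandated layout (single-conjunct summit).
set_option linter.dupNamespace false

namespace Summit.KontsevichZagierPeriods.KontsevichZagierPeriods.TypeAGenerationLine

open Finsupp MvPowerSeries
open Literature.NumberTheory.Transcendental
open Literature.NumberTheory.Transcendental.AyoubRel
open Summit.KontsevichZagierPeriods.KontsevichZagierPeriods.Theses.SymplecticScissors (TypeAGeneration)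

/-! ## Anisotropic weights -/

/-- `w^{d+e} = w^d · w^e`. [folklore] -/
theorem s3_wprod_add (w : ℕ → ℝ) (d e : ℕ →₀ ℕ) :
    ((d + e).prod fun l n => w l ^ n) = (d.prod fun l n => w l ^ n) * e.prod fun l n => w l ^ n :=
  Finsupp.prod_add_index' (fun _ => pow_zero _) fun _ _ _ => pow_add _ _ _

/-- `w^{m e_l} = (w l)^m`. [folklore] -/
theorem s3_wprod_single (w : ℕ → ℝ) (l m : ℕ) :
    ((single l m).prod fun l n => w l ^ n) = w l ^ m :=
  Finsupp.prod_single_index (pow_zero _)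

/-- `w^d` only sees `w` on the support of `d`. [folklore] -/
theorem s3_wprod_congr {w w' : ℕ → ℝ} {d : ℕ →₀ ℕ} (h : ∀ l ∈ d.support, w l = w' l) :
    (d.prod fun l n => w l ^ n) = d.prod fun l n => w' l ^ n :=
  Finsupp.prod_congr fun l hl => by rw [h l hl]

/-- `w^d = w^{d − dᵢ eᵢ} · (w i)^{dᵢ}`. [folklore] -/
theorem s3_wprod_split (w : ℕ → ℝ) (d : ℕ →₀ ℕ) (i : ℕ) :
    (d.prod fun l n => w l ^ n) = ((d.erase i).prod fun l n => w l ^ n) * w i ^ (d i) := by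
  conv_lhs => rw [← erase_add_single i d]
  rw [s3_wprod_add, s3_wprod_single]

/-- `0 ≤ w^d` for `w ≥ 0`. [folklore] -/
theorem s3_wprod_nonneg {w : ℕ → ℝ} (hw : ∀ l, 0 ≤ w l) (d : ℕ →₀ ℕ) :
    0 ≤ d.prod fun l n => w l ^ n :=
  Finset.prod_nonneg fun l _ => pow_nonneg (hw l) _

/-- **Anisotropic weights for `T = F(zᵢ(1 − μ z_j), w)`**: for `θᵢ, θ_j ≥ 0` with
`θᵢ (1 + μ θ_j) ≤ ρᵢ`, `Σ_e ‖T_e‖ ρ[i ↦ θᵢ][j ↦ θ_j]^e ≤ Σ_a ‖F_a‖ ρ^a < ∞` (fibrewise over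
`e = d + m e_j`: `Σ_m C(dᵢ, m) μ^m θ_j^m = (1 + μ θ_j)^{dᵢ}`). [folklore] -/
theorem s3_summable_weights {F : CSeries} {ρ : ℕ → ℝ} (hρ : ∀ l, 0 ≤ ρ l)
    (hs : Summable fun a : ℕ →₀ ℕ => ‖coeff a F‖ * a.prod fun l n => ρ l ^ n)
    {i j : ℕ} (hij : i ≠ j) (hj : ¬ UsesVar F j) {μ : ℚ} (hμ : 0 < μ) {θi θj : ℝ}
    (hθi : 0 ≤ θi) (hθj : 0 ≤ θj) (hθ : θi * (1 + (μ : ℝ) * θj) ≤ ρ i) :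
    Summable fun a : ℕ →₀ ℕ =>
      ‖coeff a (subst (fun l : ℕ => if l = i then (X i - C (μ : ℂ) * (X i * X j) : CSeries) else X l) F)‖ *
        a.prod fun l n => (Function.update (Function.update ρ i θi) j θj) l ^ n := by
  classical
  set W : ℕ → ℝ := Function.update (Function.update ρ i θi) j θj with hW
  have hWj : W j = θj := by rw [hW, Function.update_self]
  have hWi : W i = θi := by rw [hW, Function.update_of_ne hij, Function.update_self]
  have hWl : ∀ l, l ≠ i → l ≠ j → W l = ρ l := fun l hli hlj => by
    rw [hW, Function.update_of_ne hlj, Function.update_of_ne hli]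
  have hWnn : ∀ l, 0 ≤ W l := by
    intro l
    by_cases hlj : l = j
    · rw [hlj, hWj]; exact hθj
    · by_cases hli : l = i
      · rw [hli, hWi]; exact hθi
      · rw [hWl l hli hlj]; exact hρ l
  set T : CSeries := subst (fun l : ℕ => if l = i then (X i - C (μ : ℂ) * (X i * X j) : CSeries) else X l) F
    with hT
  set g : (ℕ →₀ ℕ) → ℝ := fun a => ‖coeff a T‖ * a.prod fun l n => W l ^ n with hg
  have hgnn : ∀ a, 0 ≤ g a := fun a => mul_nonneg (norm_nonneg _) (s3_wprod_nonneg hWnn a)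
  -- the fibred family on `(ℕ →₀ ℕ) × ℕ`
  set h : (ℕ →₀ ℕ) × ℕ → ℝ := fun p => if p.1 j = 0 then g (p.1 + single j p.2) else 0 with hh
  have hhnn : 0 ≤ h := fun p => by
    simp only [hh, Pi.zero_apply]
    split_ifs
    · exact hgnn _
    · exact le_rfl
  have hval : ∀ d : ℕ →₀ ℕ, d j = 0 → ∀ m : ℕ, h (d, m) =
      ‖coeff d F‖ * ((d.erase i).prod fun l n => ρ l ^ n) * θi ^ (d i) *
        ((((d i).choose m : ℕ) : ℝ) * ((μ : ℝ) * θj) ^ m) := by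
    intro d hd m
    have hsupp : ∀ l ∈ (d.erase i).support, W l = ρ l := by
      intro l hl
      rw [Finsupp.mem_support_iff] at hl
      have hli : l ≠ i := fun hli => by
        rw [hli, erase_same] at hl
        exact hl rfl
      have hlj : l ≠ j := fun hlj => by
        rw [hlj, erase_ne (Ne.symm hij)] at hl
        exact hl hd
      exact hWl l hli hlj
    simp only [hh, if_pos hd, hg]
    rw [hT, s3_coeff_subst_add_single hij hj _ hd, norm_mul, norm_mul, norm_pow, norm_neg,
      Complex.norm_natCast, Complex.norm_ratCast, abs_of_pos (by exact_mod_cast hμ),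
      s3_wprod_add, s3_wprod_single, hWj, s3_wprod_split W d i, hWi, s3_wprod_congr hsupp,
      mul_pow]
    ring
  have hfib : ∀ d : ℕ →₀ ℕ, d j = 0 → ∀ m ∉ Finset.range (d i + 1), h (d, m) = 0 := by
    intro d hd m hm
    rw [Finset.mem_range, not_lt] at hm
    rw [hval d hd m, Nat.choose_eq_zero_of_lt (by omega), Nat.cast_zero, zero_mul, mul_zero]
  have hfib0 : ∀ d : ℕ →₀ ℕ, d j ≠ 0 → ∀ m, h (d, m) = 0 := by
    intro d hd m
    simp only [hh, if_neg hd]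
  have hsum1 : ∀ d : ℕ →₀ ℕ, Summable fun m => h (d, m) := by
    intro d
    by_cases hd : d j = 0
    · exact summable_of_ne_finset_zero (hfib d hd)
    · exact summable_zero.congr fun m => (hfib0 d hd m).symm
  have hbound : ∀ d : ℕ →₀ ℕ, ∑' m, h (d, m) ≤ ‖coeff d F‖ * d.prod fun l n => ρ l ^ n := by
    intro d
    have hP : 0 ≤ (d.erase i).prod fun l n => ρ l ^ n := s3_wprod_nonneg hρ _
    by_cases hd : d j = 0
    · rw [tsum_eq_sum (hfib d hd)]
      simp only [hval d hd]
      rw [← Finset.mul_sum]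
      have hbin : ∑ m ∈ Finset.range (d i + 1), (((d i).choose m : ℕ) : ℝ) * ((μ : ℝ) * θj) ^ m =
          ((μ : ℝ) * θj + 1) ^ (d i) := by
        rw [add_pow]
        refine Finset.sum_congr rfl fun m _ => ?_
        rw [one_pow, mul_one, mul_comm]
      have hpow : (θi * ((μ : ℝ) * θj + 1)) ^ (d i) ≤ ρ i ^ (d i) :=
        pow_le_pow_left₀ (by positivity) (by rw [add_comm]; exact hθ) _
      rw [hbin]
      calc ‖coeff d F‖ * ((d.erase i).prod fun l n => ρ l ^ n) * θi ^ (d i) *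
            ((μ : ℝ) * θj + 1) ^ (d i)
          = ‖coeff d F‖ * ((d.erase i).prod fun l n => ρ l ^ n) *
              (θi * ((μ : ℝ) * θj + 1)) ^ (d i) := by rw [mul_pow]; ring
        _ ≤ ‖coeff d F‖ * ((d.erase i).prod fun l n => ρ l ^ n) * ρ i ^ (d i) := by
            gcongr
        _ = ‖coeff d F‖ * d.prod fun l n => ρ l ^ n := by rw [s3_wprod_split ρ d i, mul_assoc]
    · simp only [hfib0 d hd, tsum_zero]
      exact mul_nonneg (norm_nonneg _) (s3_wprod_nonneg hρ _)
  have hsum2 : Summable fun d : ℕ →₀ ℕ => ∑' m, h (d, m) :=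
    Summable.of_nonneg_of_le (fun d => tsum_nonneg fun m => hhnn (d, m)) hbound hs
  have hhsum : Summable h := (summable_prod_of_nonneg hhnn).mpr ⟨hsum1, hsum2⟩
  -- transport along `e ↦ (e − e_j e_j, e_j)`
  have hinj : Function.Injective fun e : ℕ →₀ ℕ => (e.erase j, e j) := by
    intro e e' hee
    simp only [Prod.mk.injEq] at hee
    rw [← erase_add_single j e, ← erase_add_single j e', hee.1, hee.2]
  refine (hhsum.comp_injective hinj).congr fun e => ?_
  show h (e.erase j, e j) = g e
  simp only [hh]
  rw [if_pos erase_same, erase_add_single]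

/-- A finite family of reals `> 1` has a lower bound `> 1`. [folklore] -/
theorem s3_exists_lower (ρ : ℕ → ℝ) (hρ : ∀ l, 1 < ρ l) (M : ℕ) :
    ∃ r : ℝ, 1 < r ∧ ∀ l, l < M → r ≤ ρ l := by
  induction M with
  | zero => exact ⟨2, one_lt_two, fun l hl => absurd hl (Nat.not_lt_zero l)⟩
  | succ M ih =>
    obtain ⟨r, hr1, hr⟩ := ih
    refine ⟨min r (ρ M), lt_min hr1 (hρ M), fun l hl => ?_⟩
    rcases Nat.lt_succ_iff_lt_or_eq.mp hl with h | rfl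
    · exact (min_le_left _ _).trans (hr l h)
    · exact min_le_right _ _

/-- Room in direction `i`: some `t > 1` with `t (1 + μ t) ≤ ρᵢ` when `0 < μ < ρᵢ − 1`
(`t = 1 + ε`, `ε = min 1 (δ / (1 + 3μ))`, `δ = ρᵢ − 1 − μ`). [folklore] -/
theorem s3_exists_t {μ ρi : ℝ} (hμ : 0 < μ) (hμρ : μ < ρi - 1) :
    ∃ t : ℝ, 1 < t ∧ t * (1 + μ * t) ≤ ρi := by
  set δ := ρi - 1 - μ with hδ
  have hδ0 : 0 < δ := by rw [hδ]; linarith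
  have h13 : 0 < 1 + 3 * μ := by linarith
  set ε := min 1 (δ / (1 + 3 * μ)) with hε
  have hε0 : 0 < ε := lt_min one_pos (div_pos hδ0 h13)
  have hε1 : ε ≤ 1 := min_le_left _ _
  have hε2 : ε * (1 + 3 * μ) ≤ δ := by
    have h := min_le_right 1 (δ / (1 + 3 * μ))
    rwa [← hε, le_div_iff₀ h13] at h
  refine ⟨1 + ε, by linarith, ?_⟩
  nlinarith [mul_nonneg (mul_nonneg hμ.le hε0.le) (sub_nonneg.mpr hε1)]

/-- **Polyradius of `T`** from the weights at `θᵢ = θ_j = t`, `t (1 + μ t) ≤ ρᵢ`, `t > 1`: on the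
finitely many variables of `T` the weights are bounded below by some `r₁ > 1`. [folklore] -/
theorem s3_hasPolyradiusGtOne {F : CSeries} {m₀ : ℕ} (hm₀ : DependsOnlyOnLT F m₀) {ρ : ℕ → ℝ}
    (hρ : ∀ l, 1 < ρ l)
    (hs : Summable fun a : ℕ →₀ ℕ => ‖coeff a F‖ * a.prod fun l n => ρ l ^ n)
    {i j : ℕ} (hij : i ≠ j) (hj : ¬ UsesVar F j) {μ : ℚ} (hμ : 0 < μ) (hμρ : (μ : ℝ) < ρ i - 1) :
    HasPolyradiusGtOne
      (subst (fun l : ℕ => if l = i then (X i - C (μ : ℂ) * (X i * X j) : CSeries) else X l) F) := by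
  classical
  set T : CSeries := subst (fun l : ℕ => if l = i then (X i - C (μ : ℂ) * (X i * X j) : CSeries) else X l) F
    with hT
  obtain ⟨t, ht1, ht⟩ := s3_exists_t (by exact_mod_cast hμ) hμρ
  have ht0 : 0 ≤ t := zero_le_one.trans ht1.le
  have hW := s3_summable_weights (fun l => zero_le_one.trans (hρ l).le) hs hij hj hμ ht0 ht0 ht
  obtain ⟨r, hr1, hr⟩ := s3_exists_lower ρ hρ m₀
  set r₁ := min t r with hr₁
  have hr₁1 : 1 < r₁ := lt_min ht1 hr1
  have hr₁0 : 0 ≤ r₁ := zero_le_one.trans hr₁1.le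
  refine ⟨r₁, hr₁1, Summable.of_nonneg_of_le (fun a => by positivity) (fun e => ?_) hW⟩
  by_cases he : coeff e T = 0
  · rw [he, norm_zero, zero_mul, zero_mul]
  · refine mul_le_mul_of_nonneg_left ?_ (norm_nonneg _)
    rw [degree_apply, ← Finset.prod_pow_eq_pow_sum, Finsupp.prod]
    refine Finset.prod_le_prod (fun l _ => pow_nonneg hr₁0 _) fun l hl => ?_
    refine pow_le_pow_left₀ hr₁0 ?_ _
    rw [Finsupp.mem_support_iff] at hl
    have hvar : l = j ∨ UsesVar F l := s3_usesVar hij hj _ l ⟨e, hl, he⟩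
    by_cases hlj : l = j
    · rw [hlj, Function.update_self]
      exact min_le_left _ _
    · rw [Function.update_of_ne hlj]
      by_cases hli : l = i
      · rw [hli, Function.update_self]
        exact min_le_left _ _
      · rw [Function.update_of_ne hli]
        rcases hvar with h | ⟨a, hal, hne⟩
        · exact absurd h hlj
        · have hlm : l < m₀ := by
            by_contra hge
            exact hne (hm₀ a ⟨l, not_lt.mp hge, hal⟩)
          exact (min_le_right _ _).trans (hr l hlm)

/-! ## The registered stub -/

/-- **S3 — the substituted series `T = F(zᵢ(1 − μ z_j), w)` is in `𝒪_{k-alg}(𝔻̄^∞)`, with weights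
and variables.** Under the hypotheses of S2 (without `μ < 1`): `T ∈ 𝒪_{k-alg}(𝔻̄^∞)` (algebraic by
transport along the injective substitution `zᵢ ↦ zᵢ − μ zᵢ z_j` of `k[z]`, which commutes with
`polyToCSeries`; polyradius from the weights), for all `θᵢ, θ_j ≥ 0` with `θᵢ (1 + μ θ_j) ≤ ρᵢ` the
weights `ρ[i ↦ θᵢ][j ↦ θ_j]` are summable for `T` (majorant `Σ ‖F_a‖ ρ^β θᵢⁿ (1 + μ θ_j)ⁿ`), and `T`
involves only `z_j` and the variables of `F`. [folklore] -/
theorem stub_substRoom :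
    ∀ (k : Type) [Field k] [CharZero k] (σ : k →+* ℂ) (F : CSeries), F ∈ Oan σ →
      ∀ (ρ : ℕ → ℝ), (∀ l, 1 < ρ l) →
        Summable (fun a : ℕ →₀ ℕ => ‖MvPowerSeries.coeff a F‖ * a.prod fun l n => ρ l ^ n) →
      ∀ (i j : ℕ), i ≠ j → ¬ UsesVar F j →
      ∀ (μ : ℚ), 0 < μ → ((μ : ℝ) < ρ i - 1) →
        MvPowerSeries.subst
            (fun l : ℕ => if l = i then (X i - C ((μ : ℚ) : ℂ) * (X i * X j) : CSeries) else X l) F ∈ Oan σ ∧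
        (∀ θi θj : ℝ, 0 ≤ θi → 0 ≤ θj → θi * (1 + (μ : ℝ) * θj) ≤ ρ i →
          Summable (fun a : ℕ →₀ ℕ =>
            ‖MvPowerSeries.coeff a (MvPowerSeries.subst
              (fun l : ℕ => if l = i then (X i - C ((μ : ℚ) : ℂ) * (X i * X j) : CSeries) else X l) F)‖ *
              a.prod fun l n => (Function.update (Function.update ρ i θi) j θj) l ^ n)) ∧
        (∀ l : ℕ, UsesVar (MvPowerSeries.subst
            (fun l : ℕ => if l = i then (X i - C ((μ : ℚ) : ℂ) * (X i * X j) : CSeries) else X l) F) l →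
          l = j ∨ UsesVar F l) := by
  intro k _ _ σ F hF ρ hρ hs i j hij hj μ hμ hμρ
  obtain ⟨⟨m₀, hm₀⟩, _, halg⟩ := hF
  have hvars := fun l hl => s3_usesVar hij hj ((μ : ℚ) : ℂ) l hl
  refine ⟨⟨⟨max m₀ (j + 1), ?_⟩, s3_hasPolyradiusGtOne hm₀ hρ hs hij hj hμ hμρ,
      s3_isAlgebraic σ halg hij μ⟩,
    fun θi θj hθi hθj hθ =>
      s3_summable_weights (fun l => zero_le_one.trans (hρ l).le) hs hij hj hμ hθi hθj hθ,
    hvars⟩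
  rintro e ⟨l, hl, hel⟩
  by_contra hne
  rcases hvars l ⟨e, hel, hne⟩ with rfl | ⟨a, hal, hne'⟩
  · omega
  · exact hne' (hm₀ a ⟨l, (le_max_left _ _).trans hl, hal⟩)

end Summit.KontsevichZagierPeriods.KontsevichZagierPeriods.TypeAGenerationLine
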